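import Summits.Ventures.HSemireg.WedgeHankelRecurrenceGaussChebyshevMarkovSecondKind

/-!
# Venture HSemireg — **EXPLICIT INTERLACING OF THE REAL ROOTS: for `1 ≤ k ≤ n`, `2cos((k+1)π∕(n+2)) < 2cos(kπ∕(n+1)) < 2cos(kπ∕(n+2))` (the `k`-th root of `S_n` lies strictly between the `k`-th and
# `(k+1)`-st roots of `S_{n+1}`), `2cos((2k+1)π∕(2n+2)) < 2cos((2k−1)π∕2n) < 2cos((2k−1)π∕(2n+2))` (`C_n` versus `C_{n+1}`), and `2cos((2k+1)π∕2n) < 2cos(kπ∕n) < 2cos((2k−1)π∕2n)` (the roots of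
# `S_{n−1}` — the extrema of `C_n` — separate the roots of `C_n`)** (the root multisets themselves are N500; here the order relations, from the strict monotonicity of `cos` on `[0, π]`)

HONEST FRAMING. Part of the Lean index of the computation cell `pub-hsemireg` (seat p10 gen 49, Sunday typer «UNIFORM-IN-n»).  Real inequalities only (Mathlib `Real.cos_lt_cos_of_nonneg_of_le_pi`); no
variety, no cohomology theory, no sheaf, no Ext group and no semiregularity map is constructed here; nothing here says that HC / HC_CM / HC_AV holds; no Literature fact (unproved `Prop`) is declared
or used.  Custodian versions as in `WedgeHankelSiegelIdeal` (1/3).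
SOURCES (cited).  G. Szegő, *Orthogonal Polynomials* (AMS 1939/1975), Thm 3.3.2 (interlacing of the zeros of consecutive orthogonal polynomials) — here in the explicit Chebyshev case, where it is an
inequality between the angles `kπ∕(n+1)`; T. J. Rivlin, *The Chebyshev Polynomials* (Wiley 1974), §1.2.
PROOF TYPED HERE.  `kπ∕(n+2) < kπ∕(n+1) < (k+1)π∕(n+2)` (`k(n+2) < (k+1)(n+1) ⟺ k ≤ n`), `(2k−1)∕(2n+2) < (2k−1)∕(2n) < (2k+1)∕(2n+2)` (`⟺ k ≤ n`), `(2k−1)∕(2n) < k∕n < (2k+1)∕(2n)`; all angles lie in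
`[0, π]`, so Mathlib `Real.cos_lt_cos_of_nonneg_of_le_pi` applies; the rational comparisons by `div_lt_div_iff₀` ∕ `nlinarith` after casting.
DEDUP DISCLOSURE (`rg -l interlac Summits/Ventures/HSemireg` lists the GENERAL interlacing leaves `GaussNodesInterlace`, `GaussAssociatedInterlace`, `GaussShiftInterlace`, `GaussMinorInterlace` (Jacobi-matrix
∕ Sturm arguments for arbitrary weights) and none of the `GaussChebyshev*` leaves; the explicit cosine inequalities are not typed; Mathlib has `strictAntiOn_cos`-type monotonicity only, 2026-09-04):
0 hits for the 4 names below.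

WHAT IS IN THE TREE.  N500 `chebyshevS_roots_real`, `chebyshevC_roots_real` (the root multisets these inequalities order); Mathlib `Real.cos_lt_cos_of_nonneg_of_le_pi`, `Real.pi_pos`.
THIS FILE (namespace `Summit.Ventures.HSemireg.Wedge.HankelOuter` continued; CHAINED on N542; 0 definitions):
* §1308 `two_mul_cos_lt_two_mul_cos` (monotonicity helper), **`chebyshevS_roots_interlace`** (`1 ≤ k ≤ n`: `2cos((k+1)π∕(n+2)) < 2cos(kπ∕(n+1)) < 2cos(kπ∕(n+2))`), **`chebyshevC_roots_interlace`** (`k < n`: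
  `2cos((2k+3)π∕(2n+2)) < 2cos((2k+1)π∕2n) < 2cos((2k+1)π∕(2n+2))`), **`chebyshevC_roots_extrema_interlace`** (`1 ≤ k < n`: `2cos((2k+1)π∕2n) < 2cos(kπ∕n) < 2cos((2k−1)π∕2n)`).
CAVEATS.  Indices as natural numbers with the stated side conditions; each statement is a conjunction of the two strict inequalities.  Nothing Ext-side.  New names only.
-/

open Module Polynomial
open scoped Matrix Polynomial

namespace Summit.Ventures.HSemireg.Wedge.HankelOuter

/-! ## §1308. Interlacing inequalities between the roots `2cos(·)` -/

/-- Strict monotonicity of `2cos` on `[0, π]` in the form used below (Mathlib `Real.cos_lt_cos_of_nonneg_of_le_pi`). [this file, §1308] -/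
theorem two_mul_cos_lt_two_mul_cos {a b : ℝ} (ha : 0 ≤ a) (hb : b ≤ Real.pi) (hab : a < b) : 2 * Real.cos b < 2 * Real.cos a := by
  have h := Real.cos_lt_cos_of_nonneg_of_le_pi ha hb hab
  linarith

/-- **The roots of `S_n` and `S_{n+1}` interlace: `2cos((k+1)π∕(n+2)) < 2cos(kπ∕(n+1)) < 2cos(kπ∕(n+2))` for `1 ≤ k ≤ n`.** [Szegő Thm 3.3.2; Rivlin 1974, §1.2; this file, §1308] -/
theorem chebyshevS_roots_interlace {n k : ℕ} (hk : 1 ≤ k) (hkn : k ≤ n) :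
    2 * Real.cos ((k + 1) * Real.pi / (n + 2)) < 2 * Real.cos (k * Real.pi / (n + 1)) ∧ 2 * Real.cos (k * Real.pi / (n + 1)) < 2 * Real.cos (k * Real.pi / (n + 2)) := by
  have hπ := Real.pi_pos
  have hk' : (1 : ℝ) ≤ k := by exact_mod_cast hk
  have hkn' : (k : ℝ) ≤ n := by exact_mod_cast hkn
  have hn1 : (0 : ℝ) < n + 1 := by positivity
  have hn2 : (0 : ℝ) < n + 2 := by positivity
  constructor
  · refine two_mul_cos_lt_two_mul_cos (by positivity) ?_ ?_
    · rw [div_le_iff₀ hn2]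
      nlinarith
    · rw [div_lt_div_iff₀ hn1 hn2]
      nlinarith
  · refine two_mul_cos_lt_two_mul_cos (by positivity) ?_ ?_
    · rw [div_le_iff₀ hn1]
      nlinarith
    · rw [div_lt_div_iff₀ hn2 hn1]
      nlinarith

/-- **The roots of `C_n` and `C_{n+1}` interlace: `2cos((2k+3)π∕(2n+2)) < 2cos((2k+1)π∕2n) < 2cos((2k+1)π∕(2n+2))` for `k < n`.** [Szegő Thm 3.3.2; Rivlin 1974, §1.2; this file, §1308] -/
theorem chebyshevC_roots_interlace {n k : ℕ} (hkn : k < n) :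
    2 * Real.cos ((2 * k + 3) * Real.pi / (2 * n + 2)) < 2 * Real.cos ((2 * k + 1) * Real.pi / (2 * n)) ∧
      2 * Real.cos ((2 * k + 1) * Real.pi / (2 * n)) < 2 * Real.cos ((2 * k + 1) * Real.pi / (2 * n + 2)) := by
  have hπ := Real.pi_pos
  have hkn' : (k : ℝ) + 1 ≤ n := by exact_mod_cast hkn
  have hn : (0 : ℝ) < 2 * n := by linarith
  have hn2 : (0 : ℝ) < 2 * n + 2 := by linarith
  constructor
  · refine two_mul_cos_lt_two_mul_cos (by positivity) ?_ ?_
    · rw [div_le_iff₀ hn2]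
      nlinarith
    · rw [div_lt_div_iff₀ hn hn2]
      nlinarith
  · refine two_mul_cos_lt_two_mul_cos (by positivity) ?_ ?_
    · rw [div_le_iff₀ hn]
      nlinarith
    · rw [div_lt_div_iff₀ hn2 hn]
      nlinarith

/-- **The roots of `S_{n−1}` (the extrema of `C_n`) separate the roots of `C_n`: `2cos((2k+1)π∕2n) < 2cos(kπ∕n) < 2cos((2k−1)π∕2n)` for `1 ≤ k < n`.** [Rivlin 1974, §1.2; this file, §1308] -/
theorem chebyshevC_roots_extrema_interlace {n k : ℕ} (hk : 1 ≤ k) (hkn : k < n) :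
    2 * Real.cos ((2 * k + 1) * Real.pi / (2 * n)) < 2 * Real.cos (k * Real.pi / n) ∧ 2 * Real.cos (k * Real.pi / n) < 2 * Real.cos ((2 * k - 1) * Real.pi / (2 * n)) := by
  have hπ := Real.pi_pos
  have hk' : (1 : ℝ) ≤ k := by exact_mod_cast hk
  have hkn' : (k : ℝ) + 1 ≤ n := by exact_mod_cast hkn
  have hn : (0 : ℝ) < n := by linarith
  have hn2 : (0 : ℝ) < 2 * n := by linarith
  constructor
  · refine two_mul_cos_lt_two_mul_cos (by positivity) ?_ ?_
    · rw [div_le_iff₀ hn2]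
      nlinarith
    · rw [div_lt_div_iff₀ hn hn2]
      nlinarith
  · refine two_mul_cos_lt_two_mul_cos ?_ ?_ ?_
    · exact div_nonneg (mul_nonneg (by linarith) hπ.le) hn2.le
    · rw [div_le_iff₀ hn]
      nlinarith
    · rw [div_lt_div_iff₀ hn2 hn]
      nlinarith

end Summit.Ventures.HSemireg.Wedge.HankelOuter
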